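import Literature.AlgebraicTopology.KTheory.Basic
import Mathlib.Topology.TietzeExtension
import Mathlib.Analysis.Complex.Tietze
import HarnessLib

/-!
# Clutching (Milnor patching) of idempotent matrices over a closed cover

Let `X = X₁ ∪ X₂` be covered by two closed subsets with overlap `A = X₁ ∩ X₂`. The ring `C(X, ℂ)`
is the fibre product `C(X₁, ℂ) ×_{C(A, ℂ)} C(X₂, ℂ)` (pasting lemma), and on a normal space the
restriction `C(X, ℂ) → C(A, ℂ)` is surjective (Tietze). This file proves the matrix form of the
**clutching construction** `E₁ ∪_u E₂` of vector bundles (Husemöller–Joachim–Jurčo–Schottenloher,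
Ch. 3 §7 "Collapsing and clutching vector bundles on subspaces"; Milnor's patching of projective
modules over a fibre product of rings):

* restriction homomorphisms `resHom S : C(X, ℂ) →+* C(S, ℂ)`, `resHomOfSubset`, Tietze as
  `resHom_surjective` / `matrix_map_resHom_surjective`;
* the pasting lemma `glue` and its matrix forms `exists_matrix_of_restrict_eq`,
  `matrix_eq_of_restrict_eq`;
* **Whitehead's lemma** in explicit form: `E(u) F(-v) E(u) J = u ⊕ v` for `uv = vu = 1`
  (`whitehead_identity`; Cortiñas, Prop. 2.1.4), the invertibility of `E(a) F(b) E(a) J` for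
  *all* `a, b` (`whitehead_product_mul_inv/inv_mul`) and hence the **lift** of `u ⊕ u⁻¹` to an
  invertible matrix along any ring homomorphism surjective on the entries
  (`exists_lift_fromBlocks`);
* `algEquivalent_of_cover` — algebraic equivalences over `X₁` and `X₂` agreeing on `A` glue;
* **`exists_idempotent_of_clutching`** / `exists_idem_of_clutching` — idempotents `P₁` over
  `X₁`, `P₂` over `X₂` conjugate over `A` by an invertible `u` glue to an idempotent `Q` over `X`
  with `Q|_{X₁} = P₁ ⊕ 0` and `Q|_{X₂} ∼ P₂` (`Q = L⁻¹ (P₂ ⊕ 0) L` on `X₂` for a Whitehead lift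
  `L` of `u ⊕ u⁻¹`).

Everything is proved; no named facts.

## References

* D. Husemöller, M. Joachim, B. Jurčo, M. Schottenloher, *Basic Bundle Theory and K-Cohomology
  Invariants*, LNP 726 (2008) [HusemollerEtAl2008]: Ch. 3 §7 (7.2) clutching `E' ∪_α E''`,
  (7.4) functoriality; Ch. 3 Rem. 4.6 (Tietze: `C(X) → C(A)` surjective for closed `A`).
* G. Cortiñas, in Baum et al., *Topics in Algebraic and Topological K-Theory*, LNM 2008 (2011)
  [BaumEtAl2011]: §2.1 Prop. 2.1.4 (Whitehead's lemma `diag(α, α⁻¹) ∈ E₂ₙ(R)`).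

## Design notes

* The overlap is the subtype of `X₁ ∩ X₂ : Set X`; restrictions from `X₁`, `X₂` to it are
  `resHomOfSubset inter_subset_left/right`.
* Only normality of `X` is used (Tietze for `ℂ`-valued functions, Mathlib's
  `ContinuousMap.exists_restrict_eq` with `TietzeExtension ℂ`); no compactness.
* Mathlib searches: `ContinuousMap.liftCover` (open covers only), `ContinuousOn.union_of_isClosed`
  (used for `glue`), `ContinuousMap.exists_restrict_eq` (used); no clutching of bundles or
  patching of projective modules in Mathlib. Nothing restated.
-/

noncomputable section

namespace Literature.AlgebraicTopology.KTheory

open Literature.RingTheory.KTheory Matrix Set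

universe u

variable {X : Type u} [TopologicalSpace X]

/-! ### Restriction to subsets -/

/-- The inclusion of a subset, as a continuous map. [folklore] -/
def incl (S : Set X) : C(S, X) := ⟨Subtype.val, continuous_subtype_val⟩

/-- `incl S x = x`. [folklore] -/
@[simp] theorem incl_apply (S : Set X) (x : S) : incl S x = x := rfl

/-- The inclusion `S ↪ T` of nested subsets, as a continuous map. [folklore] -/
def inclOfSubset {S T : Set X} (h : S ⊆ T) : C(S, T) := ⟨Set.inclusion h, continuous_inclusion h⟩

/-- `inclOfSubset h x = x` in `X`. [folklore] -/
@[simp] theorem coe_inclOfSubset_apply {S T : Set X} (h : S ⊆ T) (x : S) : (inclOfSubset h x : X) = x := rfl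

/-- Restriction of functions `C(X, ℂ) → C(S, ℂ)` as a ring homomorphism. [folklore] -/
abbrev resHom (S : Set X) : C(X, ℂ) →+* C(S, ℂ) := comapRingHom (incl S)

/-- Restriction `C(T, ℂ) → C(S, ℂ)` for `S ⊆ T`. [folklore] -/
abbrev resHomOfSubset {S T : Set X} (h : S ⊆ T) : C(T, ℂ) →+* C(S, ℂ) := comapRingHom (inclOfSubset h)

/-- Restricting to `T` then to `S ⊆ T` is restricting to `S`. [folklore] -/
theorem resHomOfSubset_comp_resHom {S T : Set X} (h : S ⊆ T) :
    (resHomOfSubset h).comp (resHom T) = resHom S :=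
  RingHom.ext fun _ ↦ ContinuousMap.ext fun _ ↦ rfl

/-- Values of a restricted function. [folklore] -/
@[simp] theorem resHom_apply_apply (S : Set X) (f : C(X, ℂ)) (x : S) : resHom S f x = f x := rfl

/-- Values of a function restricted along `S ⊆ T`. [folklore] -/
@[simp] theorem resHomOfSubset_apply_apply {S T : Set X} (h : S ⊆ T) (f : C(T, ℂ)) (x : S) :
    resHomOfSubset h f x = f ⟨x, h x.2⟩ := rfl

/-- **Tietze**: on a normal space restriction of complex functions to a closed subset is
surjective. [folklore] -/
theorem resHom_surjective [NormalSpace X] {S : Set X} (hS : IsClosed S) :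
    Function.Surjective (resHom S) := fun f ↦ by
  obtain ⟨g, hg⟩ := ContinuousMap.exists_restrict_eq hS f
  exact ⟨g, by ext x; exact congrFun (congrArg DFunLike.coe hg) x⟩

/-- Entrywise Tietze: matrices over `C(S, ℂ)` lift to matrices over `C(X, ℂ)`. [folklore] -/
theorem matrix_map_resHom_surjective [NormalSpace X] {S : Set X} (hS : IsClosed S) {m n : Type*}
    (M : Matrix m n C(S, ℂ)) : ∃ N : Matrix m n C(X, ℂ), N.map (resHom S) = M := by
  choose g hg using fun i j ↦ resHom_surjective hS (M i j)
  exact ⟨Matrix.of g, Matrix.ext fun i j ↦ hg i j⟩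

/-! ### Gluing over a closed cover `X = X₁ ∪ X₂` -/

section Glue

variable {X₁ X₂ : Set X}

omit [TopologicalSpace X] in
/-- In a cover `X = X₁ ∪ X₂`, points outside `X₁` lie in `X₂`. [folklore] -/
theorem mem_right_of_not_mem_left (hcov : X₁ ∪ X₂ = univ) {x : X} (hx : x ∉ X₁) : x ∈ X₂ :=
  (hcov.symm ▸ mem_univ x : x ∈ X₁ ∪ X₂).resolve_left hx

open scoped Classical in
/-- Glue two continuous functions on closed sets covering `X` which agree on the overlap
(pasting lemma). [folklore] -/
def glue (h₁ : IsClosed X₁) (h₂ : IsClosed X₂) (hcov : X₁ ∪ X₂ = univ) {Y : Type*} [TopologicalSpace Y]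
    (f₁ : C(X₁, Y)) (f₂ : C(X₂, Y))
    (hagree : ∀ (x : X) (hx₁ : x ∈ X₁) (hx₂ : x ∈ X₂), f₁ ⟨x, hx₁⟩ = f₂ ⟨x, hx₂⟩) : C(X, Y) where
  toFun x := if hx : x ∈ X₁ then f₁ ⟨x, hx⟩ else f₂ ⟨x, mem_right_of_not_mem_left hcov hx⟩
  continuous_toFun := by
    refine continuousOn_univ.1 (hcov ▸ ContinuousOn.union_of_isClosed ?_ ?_ h₁ h₂)
    · rw [continuousOn_iff_continuous_restrict]
      convert f₁.continuous using 1
      ext ⟨x, hx⟩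
      simp [hx]
    · rw [continuousOn_iff_continuous_restrict]
      convert f₂.continuous using 1
      ext ⟨x, hx⟩
      by_cases hx₁ : x ∈ X₁
      · simp [hx₁, hagree x hx₁ hx]
      · simp [hx₁]

/-- The glued function agrees with `f₁` on `X₁`. [folklore] -/
theorem glue_apply_of_mem_left (h₁ : IsClosed X₁) (h₂ : IsClosed X₂) (hcov : X₁ ∪ X₂ = univ) {Y : Type*}
    [TopologicalSpace Y] (f₁ : C(X₁, Y)) (f₂ : C(X₂, Y)) (hagree) {x : X} (hx : x ∈ X₁) :
    glue h₁ h₂ hcov f₁ f₂ hagree x = f₁ ⟨x, hx⟩ := by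
  classical
  exact dif_pos hx

/-- The glued function agrees with `f₂` on `X₂`. [folklore] -/
theorem glue_apply_of_mem_right (h₁ : IsClosed X₁) (h₂ : IsClosed X₂) (hcov : X₁ ∪ X₂ = univ) {Y : Type*}
    [TopologicalSpace Y] (f₁ : C(X₁, Y)) (f₂ : C(X₂, Y)) (hagree) {x : X} (hx : x ∈ X₂) :
    glue h₁ h₂ hcov f₁ f₂ hagree x = f₂ ⟨x, hx⟩ := by
  classical
  by_cases hx₁ : x ∈ X₁
  · rw [glue_apply_of_mem_left h₁ h₂ hcov f₁ f₂ hagree hx₁, hagree x hx₁ hx]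
  · exact dif_neg hx₁

/-- Glue matrices over `C(X₁, ℂ)` and `C(X₂, ℂ)` whose restrictions to `X₁ ∩ X₂` agree. [folklore] -/
theorem exists_matrix_of_restrict_eq (h₁ : IsClosed X₁) (h₂ : IsClosed X₂) (hcov : X₁ ∪ X₂ = univ)
    {m n : Type*} (M₁ : Matrix m n C(X₁, ℂ)) (M₂ : Matrix m n C(X₂, ℂ))
    (hagree : M₁.map (resHomOfSubset inter_subset_left) = M₂.map (resHomOfSubset inter_subset_right)) :
    ∃ M : Matrix m n C(X, ℂ), M.map (resHom X₁) = M₁ ∧ M.map (resHom X₂) = M₂ := by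
  have hag : ∀ i j (x : X) (hx₁ : x ∈ X₁) (hx₂ : x ∈ X₂), M₁ i j ⟨x, hx₁⟩ = M₂ i j ⟨x, hx₂⟩ :=
    fun i j x hx₁ hx₂ ↦ by
      have := congrFun (congrArg DFunLike.coe (congrFun (congrFun hagree i) j)) ⟨x, hx₁, hx₂⟩
      exact this
  refine ⟨Matrix.of fun i j ↦ glue h₁ h₂ hcov (M₁ i j) (M₂ i j) (hag i j), ?_, ?_⟩
  · ext i j ⟨x, hx⟩ : 3
    exact glue_apply_of_mem_left h₁ h₂ hcov _ _ (hag i j) hx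
  · ext i j ⟨x, hx⟩ : 3
    exact glue_apply_of_mem_right h₁ h₂ hcov _ _ (hag i j) hx

/-- Functions on `X` are determined by their restrictions to a cover. [folklore] -/
theorem matrix_eq_of_restrict_eq (hcov : X₁ ∪ X₂ = univ) {m n : Type*} {M N : Matrix m n C(X, ℂ)}
    (e₁ : M.map (resHom X₁) = N.map (resHom X₁)) (e₂ : M.map (resHom X₂) = N.map (resHom X₂)) : M = N := by
  ext i j x : 3
  have hx : x ∈ X₁ ∪ X₂ := hcov ▸ mem_univ x
  rcases hx with hx | hx
  · exact congrFun (congrArg DFunLike.coe (congrFun (congrFun e₁ i) j)) ⟨x, hx⟩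
  · exact congrFun (congrArg DFunLike.coe (congrFun (congrFun e₂ i) j)) ⟨x, hx⟩

end Glue

/-! ### Whitehead's lemma: `u ⊕ u⁻¹` lifts along surjections -/

section Whitehead

variable {R : Type*} [Ring R] {n : Type*} [Fintype n] [DecidableEq n]

/-- **Whitehead's lemma** (explicit form): for `u v = 1 = v u`,
`E(u) F(-v) E(u) J = u ⊕ v` where `E(a) = (1 a; 0 1)`, `F(b) = (1 0; b 1)`, `J = (0 -1; 1 0)`.
[cite: BaumEtAl2011, §2.1 Prop. 2.1.4] -/
theorem whitehead_identity (u v : Matrix n n R) (huv : u * v = 1) (hvu : v * u = 1) :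
    Matrix.fromBlocks 1 u 0 1 * Matrix.fromBlocks 1 0 (-v) 1 * Matrix.fromBlocks 1 u 0 1 *
      Matrix.fromBlocks 0 (-1) 1 0 = Matrix.fromBlocks u 0 0 v := by
  simp only [Matrix.fromBlocks_multiply]
  congr 1 <;> simp [huv, hvu]

/-- `E(a) E(-a) = 1`. [folklore] -/
theorem upperUnipotent_mul_neg (a : Matrix n n R) :
    Matrix.fromBlocks 1 a 0 1 * Matrix.fromBlocks 1 (-a) 0 1 = (1 : Matrix (n ⊕ n) (n ⊕ n) R) := by
  simp [Matrix.fromBlocks_multiply]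

/-- `F(b) F(-b) = 1`. [folklore] -/
theorem lowerUnipotent_mul_neg (b : Matrix n n R) :
    Matrix.fromBlocks 1 0 b 1 * Matrix.fromBlocks 1 0 (-b) 1 = (1 : Matrix (n ⊕ n) (n ⊕ n) R) := by
  simp [Matrix.fromBlocks_multiply]

/-- `J J' = 1` for `J = (0 -1; 1 0)`, `J' = (0 1; -1 0)`. [folklore] -/
theorem rotJ_mul_rotJ' :
    Matrix.fromBlocks 0 (-1) 1 0 * Matrix.fromBlocks 0 1 (-1) 0 = (1 : Matrix (n ⊕ n) (n ⊕ n) R) := by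
  simp [Matrix.fromBlocks_multiply]

/-- `J' J = 1`. [folklore] -/
theorem rotJ'_mul_rotJ :
    Matrix.fromBlocks 0 1 (-1) 0 * Matrix.fromBlocks 0 (-1) 1 0 = (1 : Matrix (n ⊕ n) (n ⊕ n) R) := by
  simp [Matrix.fromBlocks_multiply]

/-- The product `E(a) F(b) E(a) J` is invertible for all `a, b`: right inverse
`J' E(-a) F(-b) E(-a)`. [folklore] -/
theorem whitehead_product_mul_inv (a b : Matrix n n R) :
    (Matrix.fromBlocks 1 a 0 1 * Matrix.fromBlocks 1 0 b 1 * Matrix.fromBlocks 1 a 0 1 *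
      Matrix.fromBlocks 0 (-1) 1 0) *
    (Matrix.fromBlocks 0 1 (-1) 0 * Matrix.fromBlocks 1 (-a) 0 1 * Matrix.fromBlocks 1 0 (-b) 1 *
      Matrix.fromBlocks 1 (-a) 0 1) = 1 := by
  simp only [Matrix.mul_assoc]
  rw [← Matrix.mul_assoc (Matrix.fromBlocks 0 (-1) 1 0), rotJ_mul_rotJ', Matrix.one_mul,
    ← Matrix.mul_assoc (Matrix.fromBlocks 1 a 0 1) (Matrix.fromBlocks 1 (-a) 0 1), upperUnipotent_mul_neg,
    Matrix.one_mul, ← Matrix.mul_assoc (Matrix.fromBlocks 1 0 b 1), lowerUnipotent_mul_neg, Matrix.one_mul,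
    upperUnipotent_mul_neg]

/-- Left inverse: `J' E(-a) F(-b) E(-a)` times `E(a) F(b) E(a) J` is `1`. [folklore] -/
theorem whitehead_product_inv_mul (a b : Matrix n n R) :
    (Matrix.fromBlocks 0 1 (-1) 0 * Matrix.fromBlocks 1 (-a) 0 1 * Matrix.fromBlocks 1 0 (-b) 1 *
      Matrix.fromBlocks 1 (-a) 0 1) *
    (Matrix.fromBlocks 1 a 0 1 * Matrix.fromBlocks 1 0 b 1 * Matrix.fromBlocks 1 a 0 1 *
      Matrix.fromBlocks 0 (-1) 1 0) = 1 := by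
  have hE := upperUnipotent_mul_neg (-a)
  have hF := lowerUnipotent_mul_neg (-b)
  simp only [neg_neg] at hE hF
  simp only [Matrix.mul_assoc]
  rw [← Matrix.mul_assoc (Matrix.fromBlocks 1 (-a) 0 1) (Matrix.fromBlocks 1 a 0 1), hE, Matrix.one_mul,
    ← Matrix.mul_assoc (Matrix.fromBlocks 1 0 (-b) 1), hF, Matrix.one_mul,
    ← Matrix.mul_assoc (Matrix.fromBlocks 1 (-a) 0 1), hE, Matrix.one_mul, rotJ'_mul_rotJ]

/-- **Whitehead lift**: if `u v = 1 = v u` over `S` and `f : R →+* S` is surjective on the entries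
of `u` and `v` (lifts `a ↦ u`, `b ↦ -v`), then `L = E(a) F(b) E(a) J` is an invertible matrix
over `R` with `f(L) = u ⊕ v`. [cite: BaumEtAl2011, §2.1 Prop. 2.1.4] -/
theorem exists_lift_fromBlocks {S : Type*} [Ring S] (f : R →+* S) {u v : Matrix n n S}
    (huv : u * v = 1) (hvu : v * u = 1) {a b : Matrix n n R} (ha : a.map f = u) (hb : b.map f = -v) :
    ∃ L L' : Matrix (n ⊕ n) (n ⊕ n) R, L * L' = 1 ∧ L' * L = 1 ∧ L.map f = Matrix.fromBlocks u 0 0 v := by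
  refine ⟨_, _, whitehead_product_mul_inv a b, whitehead_product_inv_mul a b, ?_⟩
  simp only [Matrix.map_mul, Matrix.fromBlocks_map, ha, hb, Matrix.map_zero f f.map_zero,
    Matrix.map_neg _ (map_neg f), Matrix.map_one f f.map_zero f.map_one]
  exact whitehead_identity u v huv hvu

end Whitehead

/-! ### Clutching over a closed cover -/

section Clutch

variable {X₁ X₂ : Set X}

/-- Block diagonal `u ⊕ v` times `v ⊕ u` is `1` when `u v = v u = 1`. [folklore] -/
theorem fromBlocks_diag_mul_fromBlocks_diag {R : Type*} [Ring R] {n : Type*} [Fintype n] [DecidableEq n]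
    (u v : Matrix n n R) (huv : u * v = 1) (hvu : v * u = 1) :
    Matrix.fromBlocks v 0 0 u * Matrix.fromBlocks u 0 0 v = 1 := by
  simp [Matrix.fromBlocks_multiply, huv, hvu]

/-- **Algebraic equivalences glue**: if `P ∼ Q` over `X₁` and over `X₂` by witnessing pairs that
agree on `X₁ ∩ X₂`, then `P ∼ Q` over `X = X₁ ∪ X₂` (an isomorphism of bundles is determined by
compatible isomorphisms on a closed cover). [cite: HusemollerEtAl2008, Ch. 3 §7 (7.4)] -/
theorem algEquivalent_of_cover (h₁ : IsClosed X₁) (h₂ : IsClosed X₂) (hcov : X₁ ∪ X₂ = univ)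
    {m k : Type*} [Fintype m] [Fintype k] {P : Matrix m m C(X, ℂ)} {Q : Matrix k k C(X, ℂ)}
    (hP : IsIdempotentElem P) (hQ : IsIdempotentElem Q)
    (x₁ : Matrix m k C(X₁, ℂ)) (y₁ : Matrix k m C(X₁, ℂ)) (x₂ : Matrix m k C(X₂, ℂ)) (y₂ : Matrix k m C(X₂, ℂ))
    (hxy₁ : x₁ * y₁ = P.map (resHom X₁)) (hyx₁ : y₁ * x₁ = Q.map (resHom X₁))
    (hxy₂ : x₂ * y₂ = P.map (resHom X₂)) (hyx₂ : y₂ * x₂ = Q.map (resHom X₂))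
    (hx : x₁.map (resHomOfSubset inter_subset_left) = x₂.map (resHomOfSubset inter_subset_right))
    (hy : y₁.map (resHomOfSubset inter_subset_left) = y₂.map (resHomOfSubset inter_subset_right)) :
    AlgEquivalent P Q := by
  obtain ⟨x, hx₁', hx₂'⟩ := exists_matrix_of_restrict_eq h₁ h₂ hcov x₁ x₂ hx
  obtain ⟨y, hy₁', hy₂'⟩ := exists_matrix_of_restrict_eq h₁ h₂ hcov y₁ y₂ hy
  refine AlgEquivalent.of_mul_eq hP hQ (x := x) (y := y) ?_ ?_
  · exact matrix_eq_of_restrict_eq hcov (by rw [Matrix.map_mul, hx₁', hy₁', hxy₁])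
      (by rw [Matrix.map_mul, hx₂', hy₂', hxy₂])
  · exact matrix_eq_of_restrict_eq hcov (by rw [Matrix.map_mul, hx₁', hy₁', hyx₁])
      (by rw [Matrix.map_mul, hx₂', hy₂', hyx₂])

variable [NormalSpace X]

/-- **Clutching (Milnor patching) of idempotents over a closed cover.** Let `X = X₁ ∪ X₂` be a
normal space covered by two closed sets, `A = X₁ ∩ X₂`, and let `P₁`, `P₂` be idempotent `n × n`
matrices over `C(X₁, ℂ)`, `C(X₂, ℂ)` whose restrictions to `A` are conjugate by an invertible
matrix `u` over `C(A, ℂ)` (`u P₁|_A v = P₂|_A`, `u v = v u = 1` — a "clutching function"). Then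
there is an idempotent `Q` over `C(X, ℂ)` of size `2n` with `Q|_{X₁} = P₁ ⊕ 0` and
`Q|_{X₂} ∼ P₂`: namely `Q = (P₁ ⊕ 0 on X₁, L⁻¹ (P₂ ⊕ 0) L on X₂)` for a Whitehead lift `L` of
`u ⊕ u⁻¹` over `X₂` (entries lifted by Tietze). This is the matrix form of the clutching of vector
bundles `E₁ ∪_u E₂` (Husemöller et al., Ch. 3 §7; Milnor's patching of projective modules over
`C(X) = C(X₁) ×_{C(A)} C(X₂)`). [cite: HusemollerEtAl2008, Ch. 3 §7 (7.2)] -/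
theorem exists_idempotent_of_clutching (h₁ : IsClosed X₁) (h₂ : IsClosed X₂) (hcov : X₁ ∪ X₂ = univ)
    {n : Type*} [Fintype n] [DecidableEq n]
    {P₁ : Matrix n n C(X₁, ℂ)} {P₂ : Matrix n n C(X₂, ℂ)} (hP₁ : IsIdempotentElem P₁) (hP₂ : IsIdempotentElem P₂)
    (u v : Matrix n n C(↥(X₁ ∩ X₂), ℂ)) (huv : u * v = 1) (hvu : v * u = 1)
    (hconj : u * P₁.map (resHomOfSubset inter_subset_left) * v = P₂.map (resHomOfSubset inter_subset_right)) :
    ∃ Q : Matrix (n ⊕ n) (n ⊕ n) C(X, ℂ), IsIdempotentElem Q ∧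
      Q.map (resHom X₁) = Matrix.fromBlocks P₁ 0 0 0 ∧ AlgEquivalent (Q.map (resHom X₂)) P₂ := by
  set f₁ : C(X₁, ℂ) →+* C(↥(X₁ ∩ X₂), ℂ) := resHomOfSubset inter_subset_left
  set f₂ : C(X₂, ℂ) →+* C(↥(X₁ ∩ X₂), ℂ) := resHomOfSubset inter_subset_right
  have hA : IsClosed (X₁ ∩ X₂) := h₁.inter h₂
  -- Tietze lifts of `u` and `-v` over `X`, restricted to `X₂`
  obtain ⟨a, ha⟩ := matrix_map_resHom_surjective hA u
  obtain ⟨b, hb⟩ := matrix_map_resHom_surjective hA (-v)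
  have ha₂ : (a.map (resHom X₂)).map f₂ = u := by
    rw [Matrix.map_map, ← ha]; rfl
  have hb₂ : (b.map (resHom X₂)).map f₂ = -v := by
    rw [Matrix.map_map, ← hb]; rfl
  obtain ⟨L, L', hLL', hL'L, hLf⟩ := exists_lift_fromBlocks f₂ huv hvu ha₂ hb₂
  -- the two pieces
  set Q₁ : Matrix (n ⊕ n) (n ⊕ n) C(X₁, ℂ) := Matrix.fromBlocks P₁ 0 0 0
  set Q₂ : Matrix (n ⊕ n) (n ⊕ n) C(X₂, ℂ) := L' * Matrix.fromBlocks P₂ 0 0 0 * L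
  have hQ₁ : IsIdempotentElem Q₁ := isIdempotentElem_fromBlocks hP₁ IsIdempotentElem.zero
  have hP₂0 : IsIdempotentElem (Matrix.fromBlocks P₂ 0 0 (0 : Matrix n n C(X₂, ℂ))) :=
    isIdempotentElem_fromBlocks hP₂ IsIdempotentElem.zero
  have hQ₂equiv : AlgEquivalent (Matrix.fromBlocks P₂ 0 0 (0 : Matrix n n C(X₂, ℂ))) Q₂ :=
    AlgEquivalent.conj hP₂0 hLL'
  have hQ₂ : IsIdempotentElem Q₂ := hQ₂equiv.isIdempotentElem_right
  -- they agree on `A`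
  have hL'f : L'.map f₂ * Matrix.fromBlocks u 0 0 v = 1 := by
    rw [← hLf, ← Matrix.map_mul, hL'L, Matrix.map_one _ f₂.map_zero f₂.map_one]
  have hagree : Q₁.map f₁ = Q₂.map f₂ := by
    have e1 : Q₁.map f₁ = Matrix.fromBlocks (P₁.map f₁) 0 0 0 := by
      simp only [Q₁, Matrix.fromBlocks_map, Matrix.map_zero _ f₁.map_zero]
    have e2 : (Matrix.fromBlocks P₂ 0 0 (0 : Matrix n n C(X₂, ℂ))).map f₂ =
        Matrix.fromBlocks u 0 0 v * Matrix.fromBlocks (P₁.map f₁) 0 0 0 * Matrix.fromBlocks v 0 0 u := by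
      rw [Matrix.fromBlocks_map, ← hconj]
      simp [Matrix.fromBlocks_multiply, Matrix.map_zero _ f₂.map_zero]
    rw [e1, show Q₂ = L' * Matrix.fromBlocks P₂ 0 0 0 * L from rfl, Matrix.map_mul, Matrix.map_mul, e2, hLf]
    calc Matrix.fromBlocks (P₁.map f₁) 0 0 0
        = (L'.map f₂ * Matrix.fromBlocks u 0 0 v) * Matrix.fromBlocks (P₁.map f₁) 0 0 0 *
            (Matrix.fromBlocks v 0 0 u * Matrix.fromBlocks u 0 0 v) := by
          rw [hL'f, fromBlocks_diag_mul_fromBlocks_diag u v huv hvu, Matrix.one_mul, Matrix.mul_one]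
      _ = _ := by simp only [Matrix.mul_assoc]
  -- glue
  obtain ⟨Q, hQr₁, hQr₂⟩ := exists_matrix_of_restrict_eq h₁ h₂ hcov Q₁ Q₂ hagree
  refine ⟨Q, ?_, hQr₁, hQr₂ ▸ hQ₂equiv.symm.trans (AlgEquivalent.fromBlocks_zero hP₂)⟩
  exact matrix_eq_of_restrict_eq hcov (by rw [Matrix.map_mul, hQr₁, hQ₁.eq]) (by rw [Matrix.map_mul, hQr₂, hQ₂.eq])

/-- **Clutching, `Idem` form**: idempotents `p₁` over `X₁` and `p₂` over `X₂` of the same size whose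
restrictions to `X₁ ∩ X₂` are conjugate by an invertible matrix glue to an idempotent `q` over
`X = X₁ ∪ X₂` with `q|_{X₁} ≈ p₁`, `q|_{X₂} ≈ p₂`. [cite: HusemollerEtAl2008, Ch. 3 §7 (7.2)] -/
theorem exists_idem_of_clutching (h₁ : IsClosed X₁) (h₂ : IsClosed X₂) (hcov : X₁ ∪ X₂ = univ) {n : ℕ}
    {P₁ : Matrix (Fin n) (Fin n) C(X₁, ℂ)} {P₂ : Matrix (Fin n) (Fin n) C(X₂, ℂ)}
    (hP₁ : IsIdempotentElem P₁) (hP₂ : IsIdempotentElem P₂)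
    (u v : Matrix (Fin n) (Fin n) C(↥(X₁ ∩ X₂), ℂ)) (huv : u * v = 1) (hvu : v * u = 1)
    (hconj : u * P₁.map (resHomOfSubset inter_subset_left) * v = P₂.map (resHomOfSubset inter_subset_right)) :
    ∃ q : Idem C(X, ℂ), q.map (resHom X₁) ≈ (⟨n, P₁, hP₁⟩ : Idem C(X₁, ℂ)) ∧
      q.map (resHom X₂) ≈ (⟨n, P₂, hP₂⟩ : Idem C(X₂, ℂ)) := by
  obtain ⟨Q, hQ, hQ₁, hQ₂⟩ := exists_idempotent_of_clutching h₁ h₂ hcov hP₁ hP₂ u v huv hvu hconj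
  refine ⟨Idem.ofMatrix Q hQ, ?_, ?_⟩
  · change AlgEquivalent ((Matrix.reindex _ _ Q).map (resHom X₁)) P₁
    rw [Matrix.reindex_apply, ← Matrix.submatrix_map, hQ₁]
    exact (AlgEquivalent.submatrix (isIdempotentElem_fromBlocks hP₁ IsIdempotentElem.zero) _).symm.trans
      (AlgEquivalent.fromBlocks_zero hP₁)
  · change AlgEquivalent ((Matrix.reindex _ _ Q).map (resHom X₂)) P₂
    rw [Matrix.reindex_apply, ← Matrix.submatrix_map]
    exact (AlgEquivalent.submatrix hQ₂.isIdempotentElem_left _).symm.trans hQ₂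

end Clutch

end Literature.AlgebraicTopology.KTheory

end
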